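import Summits.ValiantsHypothesis.ValiantsHypothesis.Theses.FermionizationDimension
import Summits.ValiantsHypothesis.ValiantsHypothesis.Theorems.FermionizationDimensionClassTransferStubCheapConeRealisable
import Summits.ValiantsHypothesis.ValiantsHypothesis.Theorems.ClassTransfer.Negative.ConeLevel

/-!
# Birth skeleton — crux `ClassTransfer` (item `stmt-ValiantsHypothesis-7287`), line `birth`

Route `route-ValiantsHypothesis-FermionizationDimension`, crux
`Summit.ValiantsHypothesis.ValiantsHypothesis.Theses.FermionizationDimension.ClassTransfer`
(fermionic normal form on Schur's slice: every VP family of generalized matrix functions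
`d_{χ_n} = Σ_σ χ_n(σ) ∏ x_{σ(i),i}` with `χ_n` a CLASS FUNCTION has a commutative twisting
realisation `ℓ(∏ u_{σ(i),i}) = sgn(σ)·χ_n(σ)` of quasi-polynomial dimension).

This is the route's own planned layer-2 split of the crux (route header, TWO-LAYER PLAN:
`ClassTransfer ⇐ CheapConeSmall → ConeExhaustsVP → ClassTransfer`, k = 2), typed over Mathlib only.
THE CHEAP CONE of level `D` on `S_n` is the span of the indicator functions
`σ ↦ [c₁(σ) = k ∧ σ|_S = τ|_S]` (`k ≤ n`, `S ⊆ Fin n` with `|S| ≤ D`, `τ ∈ S_n`; `c₁` = number of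
fixed points): it contains every function of `c₁`, every polynomial of weighted degree `≤ D` in the
cycle counts `c₂, …, c_D` times any function of `c₁` (character polynomials: `sgn·χ_λ` for
`b(λ) ≤ D`, Burgisser2000Immanants / Curticapean2021 easy side), and every function supported on
permutations moving `≤ D` points. Membership is written out as an explicit finite expansion with a
coefficient table `a k S τ` (no new definitions), so the two stub signatures are over Mathlib +
`Literature.Computability.AlgebraicComplexity` only.

* `stub_cheapConeRealisable` (CheapConeSmall, PROVABLE NOW, size M/L) — every function in the cheap
  cone of level `D` on `S_n` is realised multiplicatively, `ℓ(∏_i u_{σ(i),i}) = f(σ)`, by ONE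
  commutative `ℂ`-algebra of dimension `≤ (n+2)^(2D+1)`: take
  `R = ℂ[ε]/(ε^{n+1}) ⊗ ℂ[η_ab : a,b ∈ Fin n]/(monomials of degree D+1)` (dimension
  `(n+1)·C(n²+D, D) ≤ (n+1)(n²+1)^D ≤ (n+2)^(2D+1)`), `u_ab = (1 + δ_ab ε)(1 + η_ab)`, so that
  `∏_i u_{σ(i),i} = (1+ε)^{c₁(σ)} · Σ_{T ⊆ Fin n, |T| ≤ D} ∏_{i∈T} η_{σ(i),i}`; the monomials
  `ε^j η^P` (`P` a partial-permutation graph) are linearly independent, and since `(C(k,j))_{j,k ≤ n}`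
  is unitriangular a functional `ℓ` with `Σ_j C(k,j) ℓ(ε^j η^P) = g_P(k)` exists for any prescribed
  table `g_P : {0..n} → ℂ` (binomial inversion) — match `T = S`, `P = graph(τ|_S)`,
  `g_P(k) = Σ_{τ' : τ'|_S = τ|_S} a k S τ'`.
* `stub_coneExhaustsVP` (ConeExhaustsVP, THE ROUTE'S BET, conjecture-grade) — for every class-function
  family `χ` whose GMF family is in `VP_ℂ` there is `c` with `sgn·χ_n` in the cheap cone of level
  `(log₂ n + c)^c` for every `n` (polylogarithmic "junta level modulo c₁"; vacuous for the finitely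
  many `n` with `(log₂ n + c)^c ≥ n`, so only the asymptotics bind). TRANSFER, why easier than the
  crux: it removes the quantifier over ALL commutative Artinian algebras and replaces it by
  membership in one explicit subspace of class-function space, a statement about characters of `S_n`
  (Fourier level / character-polynomial degree) where the immanant dichotomy machinery
  (Curticapean2021, MertensMoore2013 fermionants `Σ sgn(σ) k^{c(σ)} x^σ` hard for `k ≥ 2`,
  Burgisser2000Immanants) applies; it carries exactly the crux's recorded risk (a VP family such as
  `T_n(t) = Σ sgn(σ) t^{c₂(σ)} x^σ`, if in VP, has junta level `≍ n` and kills this stub first).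
* `ClassTransfer_of : Registered.stub_coneExhaustsVP → Registered.stub_cheapConeRealisable →
  ClassTransfer` — the composition, proved here sorry-free together with the growth bookkeeping
  `(n+2)^(2(log₂ n + c)^c + 1) ≤ 2^((log₂ n + (c+3))^(c+3))` (`qp_of_polylog_level`); the final
  `example : ClassTransfer` wires the sorried stubs into it (the crux closed modulo the stubs).

Disproof used: none (no `Disproof.lean` / `_false_without_` theorem exists for this crux at
registration time; `ledger crux ls stmt-ValiantsHypothesis-7287` = no workfiles). Negatives index
(4 entries, 2026-08-17): nothing on class functions, generalized matrix functions or twisting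
dimension. Both hypotheses of `stub_coneExhaustsVP` are load-bearing: dropping the class-function
hypothesis lets in the VP family `Pf((x_ij x_ji)_{i<j}) = Σ_{σ fpf involution} ε(M(σ)) x^σ` (the
Pfaffian escape of the route header, whose small realisations would compute permanents); dropping
`VP` lets in `χ ≡ 1`, i.e. `sgn` itself, which by `stub_cheapConeRealisable` + the route's
`SimulationCost` cannot have polylogarithmic level unless `per ∈ VQP` (small cases, exact linear
algebra in the registrar's session: `sgn ∈` cone of level `D` first at `D = 2, 2, 4` for
`n = 4, 5, 6`; `2^{c(σ)}` (fermionant weight) first at `D = 3` and `2^{c₂(σ)}` first at `D = 4` for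
`n = 6`; `c₂ ∈` level 2 always) — which is also why neither stub alone, nor the pair cheaply, gives
`ClassTransfer` or the summit (BC3 probes: all 24 single-tactic probes `stub → ClassTransfer`,
`stub → ValiantsHypothesis` by `exact?` / `simpa` / `simpa [defs]` / `unfold; simpa` / `aesop` /
`unfold; aesop` fail at 400000 heartbeats).

LEAD LOG (prover-line-stmt-ValiantsHypothesis-7287-0, 2026-08-17, cycle 1). Wave 1:
`stub_cheapConeRealisable` CLOSED (p147627, semisimple realisation `ℂ^Ω`; discharged inside
`ClassTransfer_of`, so the crux is closed modulo `stub_coneExhaustsVP` alone).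
`stub_coneExhaustsVP` (held by the lead) is SUMMIT-HARD: `sgn_n` is not in the cheap cone of level
`D` once `2D + 4 ≤ n` (antisymmetrise over `D + 2` block points that `σ₀` moves off themselves —
every generator has two free block points outside `S`), so the stub at `χ ≡ 1` already gives
`¬ IsVPFamily (per)` and hence `ValiantsHypothesis` with no other input —
`valiantsHypothesis_of_stub` below (`Theorems/ClassTransfer/Negative/ConeLevel.lean`, p149705).
NEGATIVE SIDE of the crux (all landed under `Theorems/ClassTransfer/Negative/`):
* `TwoCycleWeight.lean` (p150822, with `FlatteningKernel.lean` p150186): any commutative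
  realisation of the two-cycle weight `2^{N₂(σ)} = 4^{c₂}` on `S_{2m}` has `dim ≥ m!` (block
  flattening + positive-definite coincidence kernel), so `IsVPFamily (Σ sgn 2^{N₂} x^σ) →
  ¬ ClassTransfer`, and `classTransfer_false_without_isVPFamily` (the VP hypothesis is
  load-bearing).
* `FalsifierPerHard.lean` (p151009, with `BlockSums.lean` p150534): the route's cheapest
  falsifier is PERMANENT-HARD — `per_m` is a projection of `T_{2m}(t)` via `[[0, κJ], [X, 0]]`
  (`t = 4` and the 2-cycle-free determinant `D₂ = T(0)` formal; all `t ≠ 1` on paper: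
  `T_{2m}(t)([[0,J],[B,0]]) = (-1)^m (t-1)^{m-1}(t+m-1) per B`), hence
  `IsVPFamily T(4) → VP = VNP`, `IsVPFamily D₂ → VP = VNP`.
* `EvenCycleDetPerHard.lean` (with `OddPowFree.lean` p152014, `CyclicBlockSums.lean` p152372):
  the even-cycle determinant `D^even` is permanent-hard too — three-block CYCLIC substitution,
  `D^even(X₃) = m! E_m per_m`, `E_{2k}` odd; `IsVPFamily D^even → VP = VNP`.
So every falsifier family recorded for this crux is a `VP` family only if `VP = VNP`: none can
separate `ClassTransfer` from the summit, and the crux passes all its recorded tests; but its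
structural half cannot be a stub.  Lead's verdict: `promote-stub` (see `PICKED.md`, the line
report attached as evidence, NOTES).

LEAD LOG (prover-line-stmt-ValiantsHypothesis-7287-c1-0, gen 1, 2026-08-17). No wave (one stub,
summit-hard). The LINE is dead, not just the stub: `Negative/ObliviousSplit.lean` (p154604) proves
the OBLIVIOUS-SPLIT DICHOTOMY — for EVERY circuit-independent class `X_c(n)` of functions on `S_n`,
a cut "(A) `X_c(n)` realisable in qp dimension" + "(B) `VP` class functions, sgn-twisted, lie in
`X_c(n)`" satisfies: `sgn_n ∈ X_c(n)` for all `n` ⇒ (A) alone refutes `SDimPerNotQP` (horn 1),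
else (B) alone proves `ValiantsHypothesis` (horn 2; this line is horn 2). So no reshape keeping
the composition idea survives; a viable line must consume the circuit (determinantal normal form
⇒ twisted determinant). Negative side extended: `Negative/CoverBalance.lean` (p154955),
`Negative/CoverBalanceFamilies.lean` (p155397) — cover-balance tests for ARBITRARY class functions
(`K₂(w) = Σ_δ w(2·δ) ≠ 0` or `K₃(w) = Σ_δ w(3·δ) ≠ 0` ⇒ `per_m ≤_proj d_w`; family level ⇒
`VP = VNP`), the odd-cycle cover `Σ_{σ odd order} x^σ` is permanent-hard. Verdict: `line-dead`
(`Lines/registered-dead.md`).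
FINAL (gen 1): **the CRUX ITSELF implies the summit** — `Negative/SummitHard.lean` (p157826):
`valiantsHypothesis_of_classTransfer : ClassTransfer → ValiantsHypothesis`, via
`Negative/Fermionant.lean` (p157458: `ClassTransfer ⇒ Fer_k ∉ VP`, any commutative realisation of
`σ ↦ k^{c(σ)}` on `S_{4t}` has dimension `≥ C(2t,t)`) and `Negative/FermionantVNP.lean` (p157392:
`Fer_2 = Σ_σ sgn σ 2^{c(σ)} x^σ ∈ VNP`). So every line for this crux is summit-hard and the route's
other crux is idle in its deciding theorem (`assembly_of_classTransfer_alone`).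
-/

set_option linter.dupNamespace false

namespace Summit.ValiantsHypothesis.ValiantsHypothesis.Cruxes.ClassTransfer.Birth

open Summit.ValiantsHypothesis.ValiantsHypothesis.Theses.FermionizationDimension
open Literature.Computability.AlgebraicComplexity

/-- **CheapConeSmall — THE CHEAP CONE IS REALISABLE IN POLYNOMIAL DIMENSION** (stub statement,
named): for every level `D` and every coefficient table `a`, one commutative `ℂ`-algebra of dimension
`≤ (n+2)^(2D+1)` realises the cone function `σ ↦ Σ_{k ≤ n} Σ_{|S| ≤ D} Σ_τ [c₁(σ) = k ∧ σ|_S = τ|_S]·a k S τ`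
multiplicatively. [provable-now: truncated polynomial algebra `ℂ[ε]/ε^{n+1} ⊗ ℂ[η_ab]_{≤ D}`,
`u_ab = (1 + δ_ab ε)(1 + η_ab)`, binomial inversion; Hartmann1985, Burgisser2000Immanants (the
counting algebras behind the easy immanants), HrubesYehudayoff2011 Thm 4.2 (cost model)] -/
def CheapConeRealisable : Prop :=
  ∀ (n D : ℕ) (a : ℕ → Finset (Fin n) → Equiv.Perm (Fin n) → ℂ),
    ∃ (R : Type) (_ : CommRing R) (_ : Algebra ℂ R) (_ : Module.Finite ℂ R)
      (u : Fin n → Fin n → R) (ℓ : R →ₗ[ℂ] ℂ),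
      Module.finrank ℂ R ≤ (n + 2) ^ (2 * D + 1) ∧
      ∀ σ : Equiv.Perm (Fin n), ℓ (∏ i, u (σ i) i) =
        ∑ k ∈ Finset.range (n + 1),
          ∑ S ∈ (Finset.univ : Finset (Finset (Fin n))).filter (fun S => S.card ≤ D),
            ∑ τ : Equiv.Perm (Fin n),
              if (Finset.univ.filter fun i : Fin n => σ i = i).card = k ∧ (∀ i ∈ S, σ i = τ i)
              then a k S τ else 0

/-- **ConeExhaustsVP — VP CLASS FUNCTIONS HAVE POLYLOGARITHMIC JUNTA LEVEL MODULO `c₁`** (stub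
statement, named; the route's bet): for every family of class functions `χ_n` whose generalized
matrix functions form a `VP` family over `ℂ`, there is `c` such that for every `n` the function
`sgn·χ_n` lies in the cheap cone of level `(log₂ n + c)^c`, i.e. admits an expansion
`sgn(σ)χ_n(σ) = Σ_{k ≤ n} Σ_{|S| ≤ (log₂ n + c)^c} Σ_τ [c₁(σ) = k ∧ σ|_S = τ|_S]·a k S τ`.
[conjecture-grade: the structural half of the crux; consistent with every known VP class function —
`sgn·F(c₁)`, character polynomials of bounded degree (Burgisser2000Immanants, Curticapean2021 easy
side), bounded support — and with the hardness of the fermionants (MertensMoore2013); killed first by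
`T_n(t) = Σ sgn(σ) t^{c₂(σ)} x^σ ∈ VP` (route CHEAPEST FALSIFIER)] -/
def ConeExhaustsVP : Prop :=
  ∀ χ : (n : ℕ) → Equiv.Perm (Fin n) → ℂ,
    (∀ n (σ τ : Equiv.Perm (Fin n)), IsConj σ τ → χ n σ = χ n τ) →
    Literature.Computability.AlgebraicComplexity.IsVPFamily
      (fun n => ∑ σ : Equiv.Perm (Fin n), MvPolynomial.C (χ n σ) * ∏ i : Fin n, MvPolynomial.X (σ i, i)) →
    ∃ c : ℕ, ∀ n : ℕ, ∃ a : ℕ → Finset (Fin n) → Equiv.Perm (Fin n) → ℂ,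
      ∀ σ : Equiv.Perm (Fin n), ((Equiv.Perm.sign σ : ℤ) : ℂ) * χ n σ =
        ∑ k ∈ Finset.range (n + 1),
          ∑ S ∈ (Finset.univ : Finset (Finset (Fin n))).filter (fun S => S.card ≤ (Nat.log 2 n + c) ^ c),
            ∑ τ : Equiv.Perm (Fin n),
              if (Finset.univ.filter fun i : Fin n => σ i = i).card = k ∧ (∀ i ∈ S, σ i = τ i)
              then a k S τ else 0

/-- Stub CheapConeSmall (registered obligation; signature = `CheapConeRealisable` verbatim).
CLOSED 2026-08-17 (lead wave 1, p147627,
`Theorems/FermionizationDimensionClassTransferStubCheapConeRealisable.lean`): realised by the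
SEMISIMPLE algebra `ℂ^Ω`, `Ω = Fin (n+1) × (Fin D → Option (Fin n × Fin n))` (a sum of
`(n+1)(n²+1)^D` Hadamard-twisted determinants — so cone functions even have polynomial twisted
determinantal RANK), Vandermonde inversion in the fixed-point count. [Hartmann1985,
Burgisser2000Immanants, HrubesYehudayoff2011] -/
theorem stub_cheapConeRealisable :
    ∀ (n D : ℕ) (a : ℕ → Finset (Fin n) → Equiv.Perm (Fin n) → ℂ),
      ∃ (R : Type) (_ : CommRing R) (_ : Algebra ℂ R) (_ : Module.Finite ℂ R)
        (u : Fin n → Fin n → R) (ℓ : R →ₗ[ℂ] ℂ),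
        Module.finrank ℂ R ≤ (n + 2) ^ (2 * D + 1) ∧
        ∀ σ : Equiv.Perm (Fin n), ℓ (∏ i, u (σ i) i) =
          ∑ k ∈ Finset.range (n + 1),
            ∑ S ∈ (Finset.univ : Finset (Finset (Fin n))).filter (fun S => S.card ≤ D),
              ∑ τ : Equiv.Perm (Fin n),
                if (Finset.univ.filter fun i : Fin n => σ i = i).card = k ∧ (∀ i ∈ S, σ i = τ i)
                then a k S τ else 0 :=
  -- LANDED (wave 1, p147627): Theorems/FermionizationDimensionClassTransferStubCheapConeRealisable.lean
  Summit.ValiantsHypothesis.ValiantsHypothesis.Theorems.FermionizationDimensionClassTransfer.stub_cheapConeRealisable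

/-- Stub ConeExhaustsVP (registered obligation; signature = `ConeExhaustsVP` verbatim).
[conjecture-grade: Burgisser2000Immanants, Curticapean2021, MertensMoore2013, Hartmann1985] -/
theorem stub_coneExhaustsVP :
    ∀ χ : (n : ℕ) → Equiv.Perm (Fin n) → ℂ,
      (∀ n (σ τ : Equiv.Perm (Fin n)), IsConj σ τ → χ n σ = χ n τ) →
      Literature.Computability.AlgebraicComplexity.IsVPFamily
        (fun n => ∑ σ : Equiv.Perm (Fin n), MvPolynomial.C (χ n σ) * ∏ i : Fin n, MvPolynomial.X (σ i, i)) →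
      ∃ c : ℕ, ∀ n : ℕ, ∃ a : ℕ → Finset (Fin n) → Equiv.Perm (Fin n) → ℂ,
        ∀ σ : Equiv.Perm (Fin n), ((Equiv.Perm.sign σ : ℤ) : ℂ) * χ n σ =
          ∑ k ∈ Finset.range (n + 1),
            ∑ S ∈ (Finset.univ : Finset (Finset (Fin n))).filter (fun S => S.card ≤ (Nat.log 2 n + c) ^ c),
              ∑ τ : Equiv.Perm (Fin n),
                if (Finset.univ.filter fun i : Fin n => σ i = i).card = k ∧ (∀ i ∈ S, σ i = τ i)
                then a k S τ else 0 := by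
  sorry

/-! ## Name-keyed aliases of the two stub statements (hypotheses of the composition)

`Registered.stub_X` is the statement of `stub_X` under the registered stub's short name, so that the
native skeleton audit (`#h21_check_skeleton`: hypotheses admissible iff registered obligations /
declared stubs BY NAME) accepts `ClassTransfer_of : Registered.stub_… → Registered.stub_… →
ClassTransfer` (device of `Cruxes/RestorationQP/Lines/birth.lean`). -/
namespace Registered

/-- Alias of `ConeExhaustsVP` (= the signature of `stub_coneExhaustsVP`). -/
abbrev stub_coneExhaustsVP : Prop := ConeExhaustsVP
/-- Alias of `CheapConeRealisable` (= the signature of `stub_cheapConeRealisable`). -/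
abbrev stub_cheapConeRealisable : Prop := CheapConeRealisable

end Registered

/-- Growth bookkeeping of the composition: a polylogarithmic cone level gives a quasi-polynomial
dimension, `(n+2)^(2(log₂ n + c)^c + 1) ≤ 2^((log₂ n + (c+3))^(c+3))` for every `n`. [folklore] -/
theorem qp_of_polylog_level (c : ℕ) :
    IsQPBounded (fun n => (n + 2) ^ (2 * (Nat.log 2 n + c) ^ c + 1)) := by
  refine ⟨c + 3, fun n => ?_⟩
  show (n + 2) ^ (2 * (Nat.log 2 n + c) ^ c + 1) ≤ 2 ^ ((Nat.log 2 n + (c + 3)) ^ (c + 3))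
  have hn : n < 2 ^ (Nat.log 2 n + 1) := Nat.lt_pow_succ_log_self Nat.one_lt_two n
  generalize Nat.log 2 n = L at hn ⊢
  set B : ℕ := L + (c + 3) with hB
  -- the base: `n + 2 ≤ 2^(L+2)`
  have h1 : n + 2 ≤ 2 ^ (L + 2) := by
    have h2L : 2 ^ (L + 2) = 2 ^ (L + 1) * 2 := by rw [show L + 2 = (L + 1) + 1 by omega, pow_succ]
    have hone : 1 ≤ 2 ^ (L + 1) := Nat.one_le_two_pow
    omega
  -- the exponent: `(L + 2) * (2 * (L + c)^c + 1) ≤ B ^ (c + 3)`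
  have h2 : (L + 2) * (2 * (L + c) ^ c + 1) ≤ B ^ (c + 3) := by
    have hB1 : 1 ≤ B := by omega
    have hB3 : 3 ≤ B := by omega
    have hpow : (L + c) ^ c ≤ B ^ c := Nat.pow_le_pow_left (by omega) _
    have hBc1 : 1 ≤ B ^ c := Nat.one_le_pow _ _ hB1
    have hE : 2 * (L + c) ^ c + 1 ≤ 3 * B ^ c := by omega
    calc (L + 2) * (2 * (L + c) ^ c + 1) ≤ B * (3 * B ^ c) := Nat.mul_le_mul (by omega) hE
      _ ≤ B * (B * B ^ c) := Nat.mul_le_mul_left _ (Nat.mul_le_mul_right _ hB3)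
      _ = B ^ (c + 2) := by ring
      _ ≤ B ^ (c + 3) := Nat.pow_le_pow_right hB1 (by omega)
  calc (n + 2) ^ (2 * (L + c) ^ c + 1) ≤ (2 ^ (L + 2)) ^ (2 * (L + c) ^ c + 1) :=
        Nat.pow_le_pow_left h1 _
    _ = 2 ^ ((L + 2) * (2 * (L + c) ^ c + 1)) := (pow_mul 2 _ _).symm
    _ ≤ 2 ^ (B ^ (c + 3)) := Nat.pow_le_pow_right (by norm_num) h2

/-- The algebraic half is no longer a hypothesis: `Registered.stub_cheapConeRealisable` HOLDS
(wave 1, p147627). [folklore] -/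
theorem Registered.stub_cheapConeRealisable_holds : Registered.stub_cheapConeRealisable :=
  Summit.ValiantsHypothesis.ValiantsHypothesis.Cruxes.ClassTransfer.Birth.stub_cheapConeRealisable

/-- **Composition** (the glue of the line, kernel-checked): the structural half (ConeExhaustsVP)
puts `sgn·χ_n` in the cheap cone of level `D(n) = (log₂ n + c)^c`, the algebraic half
(CheapConeSmall, now PROVED: `Registered.stub_cheapConeRealisable_holds`) realises that cone
function by one commutative algebra of dimension `≤ (n+2)^(2D(n)+1)`, and `qp_of_polylog_level`
certifies that bound quasi-polynomial.  After wave 1 the crux is closed modulo the single stub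
`stub_coneExhaustsVP`. [folklore] -/
theorem ClassTransfer_of :
    Registered.stub_coneExhaustsVP → ClassTransfer := by
  intro hB χ hclass hVP
  have hA : Registered.stub_cheapConeRealisable := Registered.stub_cheapConeRealisable_holds
  obtain ⟨c, hc⟩ := hB χ hclass hVP
  refine ⟨fun n => (n + 2) ^ (2 * (Nat.log 2 n + c) ^ c + 1), qp_of_polylog_level c, fun n => ?_⟩
  obtain ⟨a, ha⟩ := hc n
  obtain ⟨R, i₁, i₂, i₃, u, ℓ, hdim, hu⟩ := hA n ((Nat.log 2 n + c) ^ c) a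
  exact ⟨R, i₁, i₂, i₃, u, ℓ, hdim, fun σ => (hu σ).trans (ha σ).symm⟩

/-- Wiring check: the remaining registered stub feeds `ClassTransfer_of` exactly as stated, so
the skeleton is `ClassTransfer` closed modulo `stub_coneExhaustsVP` alone (the only sorry). -/
example : ClassTransfer :=
  ClassTransfer_of stub_coneExhaustsVP

/-- **CALIBRATION (lead): the remaining stub is the summit.**  `Registered.stub_coneExhaustsVP`
alone implies `ValiantsHypothesis` (landed certificate
`Theorems/ClassTransfer/Negative/ConeLevel.lean`: `sgn_n ∉` cheap cone of level `D` for
`n ≥ 2D + 4`, applied at `χ ≡ 1`). [folklore] -/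
theorem valiantsHypothesis_of_stub : Registered.stub_coneExhaustsVP → _root_.ValiantsHypothesis :=
  fun h => Summit.ValiantsHypothesis.ValiantsHypothesis.Theorems.ClassTransfer.Negative.valiantsHypothesis_of_coneExhaustsVP h

end Summit.ValiantsHypothesis.ValiantsHypothesis.Cruxes.ClassTransfer.Birth
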